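import Summits.HubbardSuperconductivity.HubbardSuperconductivity.Theorems.AnisotropyChordSpinMonotoneTwoMagnonSymmetric
import Literature.MathematicalPhysics.QuantumLattice.SpinChainsLiebMattisProofs

/-!
# Route `AnisotropyChord`: the two-magnon sector on the automorphism-invariant block of an
# edge-transitive regular graph — the XXZ Hamiltonian as `L + σ|t⟩⟨t|/|E| + const`, the ferromagnetic
# end point, Perron–Frobenius facts (toolkit II for the rung TM-VT, file `…TwoMagnonEdgeTransitive`)

Continuation of `…TwoMagnonSymmetric` (same conventions: `φ` the flat vector, `t` the contact
indicator, `K` the two-magnon sector of `H(Δ) = xxzHamiltonian 1 G (−1) Δ`, `m = |E|`):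

* `posSemidef_xxzOne_add` — `L := H(1) + (m/4)·1 = Σ_{e∈E} (¼ − 𝐒·𝐒(e)) ⪰ 0` (exchange bound);
* `xxz_mulVec_of_invariant` — on a `k`-regular EDGE-TRANSITIVE graph, for `f ∈ K` fixed by all graph
  automorphisms: `H(Δ) f = H(1) f + (1−Δ)(m/4 − k) f + ((1−Δ)/m)⟨t, f⟩ t` — the theory seat's
  `H_σ = ½L_X + σ ê` with `ê` RANK ONE on the invariant block; `re_form_of_invariant` — the quadratic
  form;
* `sectorGS_smul_of_sectorGS`, `sectorGS_flatOverlap_ne_zero` — Perron–Frobenius in the sector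
  (`xxz_sector_perronFrobenius`): uniqueness up to scalars, and `⟨φ, ψ⟩ ≠ 0` for every nonzero
  sector ground vector;
* `lowestEnergy_at_one`, `sectorGS_at_one_eq_smul_flat` — at `Δ = 1` the sector energy is `−m/4`
  and the sector ground vectors are the multiples of `φ`;
* `sectorGS_contact_ne_zero` — `⟨t, ψ⟩ ≠ 0` for every normalised invariant sector ground vector (else
  `ψ` would be an `H(1)`-eigenvector not orthogonal to `φ`, hence `∝ φ`, but `⟨t, φ⟩ = m ≠ 0`);
* `marginal_eq_of_vertexTransitive`, `condensate_eq_flatOverlap` — on a VERTEX-TRANSITIVE graph,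
  `Λ(f) = (4/|V|)|⟨φ,f⟩|² + (|V| − 4)‖f‖²` for invariant `f ∈ K`.

H. Tasaki, *Physics and Mathematics of Quantum Many-Body Systems* (2020) §2.4, App. A.3.  No definition
is introduced.
-/

set_option linter.dupNamespace false

noncomputable section

namespace Summit.HubbardSuperconductivity.HubbardSuperconductivity.Theorems.AnisotropyChord.TwoMagnon

open Matrix Complex Finset
open scoped ComplexOrder
open Literature.MathematicalPhysics.QuantumLattice
open Literature.Combinatorics.SimpleGraph (IsVertexTransitive)
open Literature.Combinatorics.SimpleGraph.LovaszThetaEdgeTransitive (IsEdgeTransitive)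
open Summit.HubbardSuperconductivity.HubbardSuperconductivity.Theorems.AnisotropyChord.OneMagnon
open Summit.HubbardSuperconductivity.HubbardSuperconductivity.Theorems.PolyaSchurPairBoson

variable {V : Type*} [Fintype V] [DecidableEq V] {G : SimpleGraph V} [DecidableRel G.Adj]

/-! ### `L = H(1) + |E|/4 ⪰ 0` -/

variable (G) in
/-- **`H(1) + |E|/4 = Σ_{e ∈ E} (¼ − 𝐒_x·𝐒_y) ⪰ 0`** (exchange bound on every edge).
Tasaki (2020) App. A.3. [folklore] -/
theorem posSemidef_xxzOne_add :
    (xxzHamiltonian 1 G (-1) 1 + (((G.edgeFinset.card : ℝ) / 4 : ℝ) : ℂ) • (1 : Op V 2)).PosSemidef := by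
  have h : (xxzHamiltonian 1 G (-1) 1 + (((G.edgeFinset.card : ℝ) / 4 : ℝ) : ℂ) • (1 : Op V 2)) =
      ∑ e ∈ G.edgeFinset, ((1 / 4 : ℂ) • (1 : Op V 2) - spinDotSym 1 e) := by
    rw [xxz_at_one_eq_neg_heisenberg, heisenbergHamiltonian, Complex.ofReal_one, one_smul,
      Finset.sum_sub_distrib, Finset.sum_const, ← Nat.cast_smul_eq_nsmul ℂ, smul_smul]
    push_cast
    rw [neg_add_eq_sub]
    congr 2
    ring
  rw [h]
  refine posSemidef_finset_sum _ fun e he => ?_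
  induction e using Sym2.ind with
  | h x y =>
    rw [SimpleGraph.mem_edgeFinset, SimpleGraph.mem_edgeSet] at he
    rw [spinDotSym_mk]
    exact posSemidef_quarter_sub_spinDot_one he.ne

/-! ### The XXZ Hamiltonian on the invariant block: rank-one contact term -/

/-- **`H(Δ) = H(1) + (1−Δ)(m/4 − k) + ((1−Δ)/m)|t⟩⟨t|` on the invariant two-magnon block** of a
`k`-regular edge-transitive graph with `m = |E| ≠ 0` edges: for `f ∈ K` fixed by all graph
automorphisms, `H(Δ) f = H(1) f + (1−Δ)(m/4−k) f + ((1−Δ)/m)⟨t,f⟩ t`. [folklore] -/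
theorem xxz_mulVec_of_invariant (hET : IsEdgeTransitive G) {k : ℕ} (hreg : G.IsRegularOfDegree k)
    (hm : G.edgeFinset.card ≠ 0) {t : (V → Fin 2) → ℂ}
    (ht2 : ∀ a b : V, a ≠ b → t (Pi.single a 1 + Pi.single b 1) = if G.Adj a b then 1 else 0)
    (ht0 : ∀ σ : V → Fin 2, (∑ z, (σ z : ℕ)) ≠ 2 → t σ = 0) {f : (V → Fin 2) → ℂ}
    (hfK : f ∈ spinZSector (Λ := V) 1 ((Fintype.card V : ℝ) / 2 - 2))
    (hfix : ∀ π : V ≃ V, (∀ x y, G.Adj (π x) (π y) ↔ G.Adj x y) → ∀ σ, f (σ ∘ π) = f σ) (Δ : ℝ) :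
    xxzHamiltonian 1 G (-1) Δ *ᵥ f =
      xxzHamiltonian 1 G (-1) 1 *ᵥ f
        + (((1 - Δ) * ((G.edgeFinset.card : ℝ) / 4 - k) : ℝ) : ℂ) • f
        + ((((1 - Δ : ℝ) : ℂ)) / (G.edgeFinset.card : ℂ) * (star t ⬝ᵥ f)) • t := by
  have hsupp := apply_eq_zero_of_mem_twoMagnonSector hfK
  have hD := isingDiag_mulVec_of_regular hreg ht2 hsupp
  have hR := card_smul_adjInd_mul_eq hET ht2 ht0 hsupp hfix
  have hmC : (G.edgeFinset.card : ℂ) ≠ 0 := by exact_mod_cast hm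
  have htf : (fun σ => t σ * f σ) = ((star t ⬝ᵥ f) / (G.edgeFinset.card : ℂ)) • t := by
    have h := congrArg (fun v => (G.edgeFinset.card : ℂ)⁻¹ • v) hR
    simp only [smul_smul, inv_mul_cancel₀ hmC, one_smul] at h
    rw [h, div_eq_inv_mul]
  -- `H(Δ) = H(1) + (1 − Δ)(H(0) − H(1))`
  have haff : xxzHamiltonian 1 G (-1) Δ *ᵥ f = xxzHamiltonian 1 G (-1) 1 *ᵥ f
      + (((1 - Δ : ℝ)) : ℂ) • ((xxzHamiltonian 1 G (-1) 0 - xxzHamiltonian 1 G (-1) 1 : Op V 2) *ᵥ f) := by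
    rw [xxzHamiltonian_affine 1 G (-1) Δ, add_mulVec, smul_mulVec, sub_mulVec, sub_mulVec]
    have h1 := xxzHamiltonian_affine 1 G (-1) 1
    rw [Complex.ofReal_one, one_smul, add_sub_cancel] at h1
    push_cast
    module
  rw [haff, hD, htf, smul_add, smul_smul, smul_smul, add_assoc]
  congr 1
  congr 1
  · congr 1
    push_cast
    ring
  · congr 1
    ring

/-- **The quadratic form on the invariant block**:
`Re⟨f, H(Δ)f⟩ = Re⟨f, H(1)f⟩ + (1−Δ)(m/4−k)‖f‖² + ((1−Δ)/m)|⟨t,f⟩|²`. [folklore] -/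
theorem re_form_of_invariant (hET : IsEdgeTransitive G) {k : ℕ} (hreg : G.IsRegularOfDegree k)
    (hm : G.edgeFinset.card ≠ 0) {t : (V → Fin 2) → ℂ}
    (ht2 : ∀ a b : V, a ≠ b → t (Pi.single a 1 + Pi.single b 1) = if G.Adj a b then 1 else 0)
    (ht0 : ∀ σ : V → Fin 2, (∑ z, (σ z : ℕ)) ≠ 2 → t σ = 0) {f : (V → Fin 2) → ℂ}
    (hfK : f ∈ spinZSector (Λ := V) 1 ((Fintype.card V : ℝ) / 2 - 2))
    (hfix : ∀ π : V ≃ V, (∀ x y, G.Adj (π x) (π y) ↔ G.Adj x y) → ∀ σ, f (σ ∘ π) = f σ) (Δ : ℝ) :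
    (star f ⬝ᵥ (xxzHamiltonian 1 G (-1) Δ *ᵥ f)).re =
      (star f ⬝ᵥ (xxzHamiltonian 1 G (-1) 1 *ᵥ f)).re
        + (1 - Δ) * ((G.edgeFinset.card : ℝ) / 4 - k) * (star f ⬝ᵥ f).re
        + (1 - Δ) / (G.edgeFinset.card : ℝ) * ‖star t ⬝ᵥ f‖ ^ 2 := by
  rw [xxz_mulVec_of_invariant hET hreg hm ht2 ht0 hfK hfix Δ, dotProduct_add, dotProduct_add,
    dotProduct_smul, dotProduct_smul, Complex.add_re, Complex.add_re, smul_eq_mul, smul_eq_mul,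
    Complex.re_ofReal_mul]
  congr 1
  have hft : star f ⬝ᵥ t = star (star t ⬝ᵥ f) := star_dotProduct f t
  rw [hft, mul_assoc, Complex.star_def, Complex.mul_conj', ← Complex.ofReal_natCast,
    ← Complex.ofReal_div, ← Complex.ofReal_pow, ← Complex.ofReal_mul, Complex.ofReal_re]

/-! ### Perron–Frobenius facts in the two-magnon sector -/

variable (G) in
/-- Perron–Frobenius uniqueness, packaged: on a connected graph two sector ground vectors of `H(Δ)`
in the same sector, the first nonzero, are proportional. Tasaki (2020) §2.4. [folklore] -/
theorem sectorGS_smul_of_sectorGS (hG : G.Connected) (Δ M : ℝ) {ψ χ : TensorIndex V 2 → ℂ}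
    (hψ : ψ ∈ spinZSector (Λ := V) 1 M) (hψ0 : ψ ≠ 0)
    (hHψ : xxzHamiltonian 1 G (-1) Δ *ᵥ ψ =
      ((lowestEnergyInSector 1 (xxzHamiltonian 1 G (-1) Δ) M : ℝ) : ℂ) • ψ)
    (hχ : χ ∈ spinZSector (Λ := V) 1 M)
    (hHχ : xxzHamiltonian 1 G (-1) Δ *ᵥ χ =
      ((lowestEnergyInSector 1 (xxzHamiltonian 1 G (-1) Δ) M : ℝ) : ℂ) • χ) :
    ∃ c : ℂ, χ = c • ψ := by
  obtain ⟨W, hW, hMW⟩ := exists_weight_of_mem_spinZSector hψ hψ0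
  subst hMW
  obtain ⟨-, huniq⟩ := xxz_sector_perronFrobenius G hG Δ W hW
  exact huniq ψ χ hψ hχ hHψ hHχ hψ0

variable (G) in
/-- **The flat overlap of a sector ground vector is nonzero**: `⟨φ, ψ⟩ ≠ 0` for every nonzero
sector ground vector `ψ` of `H(Δ)` in the two-magnon sector of a connected graph (Perron–Frobenius:
`ψ` is a multiple of an entrywise nonnegative vector, whose coordinate sum is positive). [folklore] -/
theorem sectorGS_flatOverlap_ne_zero (hG : G.Connected) (Δ : ℝ)
    {φ : (V → Fin 2) → ℂ} (hφ : ∀ σ, φ σ = if (∑ z, (σ z : ℕ)) = 2 then 1 else 0)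
    {ψ : (V → Fin 2) → ℂ} (hψ : ψ ∈ spinZSector (Λ := V) 1 ((Fintype.card V : ℝ) / 2 - 2))
    (hψ0 : ψ ≠ 0)
    (hHψ : xxzHamiltonian 1 G (-1) Δ *ᵥ ψ =
      ((lowestEnergyInSector 1 (xxzHamiltonian 1 G (-1) Δ) ((Fintype.card V : ℝ) / 2 - 2) : ℝ) : ℂ) • ψ) :
    star φ ⬝ᵥ ψ ≠ 0 := by
  obtain ⟨W, hW, hMW⟩ := exists_weight_of_mem_spinZSector hψ hψ0
  have hψ' := hψ
  have hHψ' := hHψ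
  rw [hMW] at hψ' hHψ'
  obtain ⟨⟨ψ₀, hψ₀K, hψ₀0, hψ₀pos, hψ₀H⟩, huniq⟩ := xxz_sector_perronFrobenius G hG Δ W hW
  obtain ⟨c, hc⟩ := huniq ψ₀ ψ hψ₀K hψ' hψ₀H hHψ' hψ₀0
  have hc0 : c ≠ 0 := by
    rintro rfl
    exact hψ0 (by rw [hc, zero_smul])
  rw [← hMW] at hψ₀K
  have hsum : star φ ⬝ᵥ ψ₀ = ∑ σ, ψ₀ σ :=
    star_flat_dotProduct hφ (apply_eq_zero_of_mem_twoMagnonSector hψ₀K)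
  have hS0 : (∑ σ, ψ₀ σ) ≠ 0 := by
    obtain ⟨σ₁, hσ₁⟩ : ∃ σ₁, ψ₀ σ₁ ≠ 0 := Function.ne_iff.mp hψ₀0
    intro hS
    have hre : (∑ σ, ψ₀ σ).re = 0 := by rw [hS, Complex.zero_re]
    rw [Complex.re_sum] at hre
    have hle : (ψ₀ σ₁).re ≤ ∑ σ, (ψ₀ σ).re :=
      Finset.single_le_sum (fun σ _ => (hψ₀pos σ).1) (Finset.mem_univ σ₁)
    have hpos : 0 < (ψ₀ σ₁).re := by
      rcases (hψ₀pos σ₁).1.lt_or_eq with h | h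
      · exact h
      · exact absurd (Complex.ext (by rw [Complex.zero_re]; exact h.symm)
          (by rw [Complex.zero_im]; exact (hψ₀pos σ₁).2)) hσ₁
    linarith
  rw [hc, dotProduct_smul, smul_eq_mul, hsum]
  exact mul_ne_zero hc0 hS0

variable (G) in
/-- **The sector energy at `Δ = 1` is `−|E|/4`** (two-magnon sector, nonempty): the flat vector
attains it and `H(1) + |E|/4 ⪰ 0`. Tasaki (2020) §2.4. [folklore] -/
theorem lowestEnergy_at_one {φ : (V → Fin 2) → ℂ}
    (hφ : ∀ σ, φ σ = if (∑ z, (σ z : ℕ)) = 2 then 1 else 0) (hφ0 : φ ≠ 0) :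
    lowestEnergyInSector 1 (xxzHamiltonian 1 G (-1) 1) ((Fintype.card V : ℝ) / 2 - 2) =
      -((G.edgeFinset.card : ℝ) / 4) := by
  set K := spinZSector (Λ := V) 1 ((Fintype.card V : ℝ) / 2 - 2) with hK
  have hφK : φ ∈ K := flat_mem_twoMagnonSector hφ
  have hN : star φ ⬝ᵥ φ ≠ 0 := (dotProduct_star_self_eq_zero (v := φ)).not.mpr hφ0
  refine le_antisymm ?_ ?_
  · -- upper bound by the flat vector
    have h := minEnergyOn_mul_le_re_rayleigh (xxzHamiltonian_isHermitian 1 G (-1) 1) K hφK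
    have hsc : (-((G.edgeFinset.card : ℂ) / 4)) = ((-((G.edgeFinset.card : ℝ) / 4) : ℝ) : ℂ) := by
      push_cast; ring
    rw [xxzOne_mulVec_flat G hφ, hsc, dotProduct_smul, smul_eq_mul, Complex.re_ofReal_mul] at h
    have hpos : 0 < (star φ ⬝ᵥ φ).re := by
      have h1 := Matrix.dotProduct_star_self_pos_iff.2 hφ0
      have h2 := (Complex.lt_def.1 h1).1
      rwa [Complex.zero_re] at h2
    exact le_of_mul_le_mul_right h hpos
  · -- lower bound by `L ⪰ 0`
    have hKinv : ∀ v ∈ K, xxzHamiltonian 1 G (-1) 1 *ᵥ v ∈ K := by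
      intro v hv
      rw [xxz_at_one_eq_neg_heisenberg, neg_mulVec]
      exact K.neg_mem (heisenberg_mulVec_mem_spinZSector 1 G 1 hv)
    have hKne : K ≠ ⊥ := fun h => hφ0 ((Submodule.mem_bot ℂ).1 (h ▸ hφK))
    obtain ⟨χ, hχK, hχ1, hχH⟩ :=
      exists_unit_eigen_minEnergyOn (xxzHamiltonian_isHermitian 1 G (-1) 1) K hKinv hKne
    have hE : (star χ ⬝ᵥ (xxzHamiltonian 1 G (-1) 1 *ᵥ χ)).re =
        lowestEnergyInSector 1 (xxzHamiltonian 1 G (-1) 1) ((Fintype.card V : ℝ) / 2 - 2) := by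
      rw [hχH, dotProduct_smul, hχ1, smul_eq_mul, mul_one, Complex.ofReal_re]
      rfl
    have hL := (Complex.le_def.1 ((posSemidef_xxzOne_add G).dotProduct_mulVec_nonneg χ)).1
    rw [add_mulVec, smul_mulVec, one_mulVec, dotProduct_add, dotProduct_smul, hχ1, Complex.add_re,
      Complex.zero_re, smul_eq_mul, mul_one, Complex.ofReal_re, hE] at hL
    linarith

variable (G) in
/-- **At `Δ = 1` every sector ground vector is a multiple of the flat vector** (two-magnon sector,
connected graph). [folklore] -/
theorem sectorGS_at_one_eq_smul_flat (hG : G.Connected) {φ : (V → Fin 2) → ℂ}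
    (hφ : ∀ σ, φ σ = if (∑ z, (σ z : ℕ)) = 2 then 1 else 0) (hφ0 : φ ≠ 0)
    {ψ : (V → Fin 2) → ℂ} (hψ : ψ ∈ spinZSector (Λ := V) 1 ((Fintype.card V : ℝ) / 2 - 2))
    (hHψ : xxzHamiltonian 1 G (-1) 1 *ᵥ ψ =
      ((lowestEnergyInSector 1 (xxzHamiltonian 1 G (-1) 1) ((Fintype.card V : ℝ) / 2 - 2) : ℝ) : ℂ) • ψ) :
    ∃ c : ℂ, ψ = c • φ := by
  have hHφ : xxzHamiltonian 1 G (-1) 1 *ᵥ φ =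
      ((lowestEnergyInSector 1 (xxzHamiltonian 1 G (-1) 1) ((Fintype.card V : ℝ) / 2 - 2) : ℝ) : ℂ) • φ := by
    rw [lowestEnergy_at_one G hφ hφ0, xxzOne_mulVec_flat G hφ]
    push_cast
    rfl
  exact sectorGS_smul_of_sectorGS G hG 1 _ (flat_mem_twoMagnonSector hφ) hφ0 hHφ hψ hHψ

/-- `⟨t, φ⟩`... rather `⟨t, φ⟩ = m`: the contact indicator pairs with the flat vector to the number of
edges. [folklore] -/
theorem star_adjInd_dotProduct_flat {t : (V → Fin 2) → ℂ}
    (ht2 : ∀ a b : V, a ≠ b → t (Pi.single a 1 + Pi.single b 1) = if G.Adj a b then 1 else 0)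
    (ht0 : ∀ σ : V → Fin 2, (∑ z, (σ z : ℕ)) ≠ 2 → t σ = 0) {φ : (V → Fin 2) → ℂ}
    (hφ : ∀ σ, φ σ = if (∑ z, (σ z : ℕ)) = 2 then 1 else 0) :
    star t ⬝ᵥ φ = (G.edgeFinset.card : ℂ) := by
  rw [star_adjInd_dotProduct ht2 ht0 (fun σ h => by rw [hφ σ, if_neg h])]
  have h : ∀ e ∈ G.edgeFinset, Sym2.lift ⟨fun x y => φ (Pi.single x 1 + Pi.single y 1),
      fun x y => by simp only [pair_comm x y]⟩ e = 1 := by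
    intro e he
    induction e using Sym2.ind with
    | h x y =>
      rw [SimpleGraph.mem_edgeFinset, SimpleGraph.mem_edgeSet] at he
      rw [Sym2.lift_mk]
      show φ (Pi.single x 1 + Pi.single y 1) = 1
      rw [hφ, weight_pair he.ne, if_pos rfl]
  rw [Finset.sum_congr rfl h, Finset.sum_const, nsmul_eq_mul, mul_one]

/-- **The contact amplitude of an invariant sector ground state is nonzero**: on a connected
`k`-regular edge-transitive graph with an edge, for every normalised sector ground vector `ψ` of `H(Δ)`
in the two-magnon sector fixed by all graph automorphisms, `⟨t, ψ⟩ ≠ 0`.  (Otherwise `ψ` is an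
`H(1)`-eigenvector with `⟨φ, ψ⟩ ≠ 0`, hence a ground vector at `Δ = 1`, hence `∝ φ`; but `⟨t, φ⟩ = m`.)
[folklore] -/
theorem sectorGS_contact_ne_zero (hG : G.Connected) (hET : IsEdgeTransitive G) {k : ℕ}
    (hreg : G.IsRegularOfDegree k) (hm : G.edgeFinset.card ≠ 0) {t : (V → Fin 2) → ℂ}
    (ht2 : ∀ a b : V, a ≠ b → t (Pi.single a 1 + Pi.single b 1) = if G.Adj a b then 1 else 0)
    (ht0 : ∀ σ : V → Fin 2, (∑ z, (σ z : ℕ)) ≠ 2 → t σ = 0)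
    {φ : (V → Fin 2) → ℂ} (hφ : ∀ σ, φ σ = if (∑ z, (σ z : ℕ)) = 2 then 1 else 0)
    {Δ : ℝ} {ψ : (V → Fin 2) → ℂ} (hψ : ψ ∈ spinZSector (Λ := V) 1 ((Fintype.card V : ℝ) / 2 - 2))
    (hψ1 : star ψ ⬝ᵥ ψ = 1)
    (hHψ : xxzHamiltonian 1 G (-1) Δ *ᵥ ψ =
      ((lowestEnergyInSector 1 (xxzHamiltonian 1 G (-1) Δ) ((Fintype.card V : ℝ) / 2 - 2) : ℝ) : ℂ) • ψ)
    (hfix : ∀ π : V ≃ V, (∀ x y, G.Adj (π x) (π y) ↔ G.Adj x y) → ∀ σ, ψ (σ ∘ π) = ψ σ) :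
    star t ⬝ᵥ ψ ≠ 0 := by
  intro hb
  have hψ0 : ψ ≠ 0 := by
    intro h; rw [h, dotProduct_zero] at hψ1; exact zero_ne_one hψ1
  have hφ0 : φ ≠ 0 := by
    intro h
    exact sectorGS_flatOverlap_ne_zero G hG Δ hφ hψ hψ0 hHψ (by rw [h, star_zero, zero_dotProduct])
  set E : ℝ := lowestEnergyInSector 1 (xxzHamiltonian 1 G (-1) Δ) ((Fintype.card V : ℝ) / 2 - 2)
  set c₁ : ℝ := (1 - Δ) * ((G.edgeFinset.card : ℝ) / 4 - k)
  -- `ψ` is an eigenvector of `H(1)`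
  have hH1 : xxzHamiltonian 1 G (-1) 1 *ᵥ ψ = ((E - c₁ : ℝ) : ℂ) • ψ := by
    have h := xxz_mulVec_of_invariant hET hreg hm ht2 ht0 hψ hfix Δ
    rw [hb, mul_zero, zero_smul, add_zero, hHψ] at h
    rw [Complex.ofReal_sub, sub_smul]
    exact eq_sub_of_add_eq h.symm
  -- pair with the flat vector: `(E − c₁) ⟨φ,ψ⟩ = −(m/4) ⟨φ,ψ⟩`
  have hsc : (-((G.edgeFinset.card : ℂ) / 4)) = ((-((G.edgeFinset.card : ℝ) / 4) : ℝ) : ℂ) := by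
    push_cast; ring
  have hpair : ((E - c₁ : ℝ) : ℂ) * (star φ ⬝ᵥ ψ) =
      ((-((G.edgeFinset.card : ℝ) / 4) : ℝ) : ℂ) * (star φ ⬝ᵥ ψ) := by
    have h1 : star φ ⬝ᵥ (xxzHamiltonian 1 G (-1) 1 *ᵥ ψ) = ((E - c₁ : ℝ) : ℂ) * (star φ ⬝ᵥ ψ) := by
      rw [hH1, dotProduct_smul, smul_eq_mul]
    have h2 : star φ ⬝ᵥ (xxzHamiltonian 1 G (-1) 1 *ᵥ ψ) =
        ((-((G.edgeFinset.card : ℝ) / 4) : ℝ) : ℂ) * (star φ ⬝ᵥ ψ) := by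
      rw [dotProduct_mulVec, show star φ ᵥ* xxzHamiltonian 1 G (-1) 1 =
          star ((xxzHamiltonian 1 G (-1) 1)ᴴ *ᵥ φ) by rw [star_mulVec, conjTranspose_conjTranspose],
        (xxzHamiltonian_isHermitian 1 G (-1) 1).eq, xxzOne_mulVec_flat G hφ, hsc, star_smul, smul_dotProduct,
        smul_eq_mul, Complex.star_def, Complex.conj_ofReal]
    rw [← h1, h2]
  have hEc : E - c₁ = -((G.edgeFinset.card : ℝ) / 4) := by
    have h := mul_right_cancel₀ (sectorGS_flatOverlap_ne_zero G hG Δ hφ hψ hψ0 hHψ) hpair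
    exact_mod_cast h
  -- so `ψ` is a ground vector at `Δ = 1`, hence a multiple of `φ`
  have hGS1 : xxzHamiltonian 1 G (-1) 1 *ᵥ ψ =
      ((lowestEnergyInSector 1 (xxzHamiltonian 1 G (-1) 1) ((Fintype.card V : ℝ) / 2 - 2) : ℝ) : ℂ) • ψ := by
    rw [hH1, hEc, lowestEnergy_at_one G hφ hφ0]
  obtain ⟨c, hc⟩ := sectorGS_at_one_eq_smul_flat G hG hφ hφ0 hψ hGS1
  have hc0 : c ≠ 0 := by
    rintro rfl
    exact hψ0 (by rw [hc, zero_smul])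
  rw [hc, dotProduct_smul, smul_eq_mul, star_adjInd_dotProduct_flat ht2 ht0 hφ] at hb
  exact mul_ne_zero hc0 (by exact_mod_cast hm) hb

/-! ### Vertex-transitivity: constant marginals and the condensate as a flat overlap -/

omit [DecidableEq V] in
/-- On a VERTEX-TRANSITIVE graph a vector fixed by all graph automorphisms has constant pair
marginals `Σ_{x ≠ k} f(e_k + e_x)`. [folklore] -/
theorem marginal_eq_of_vertexTransitive [DecidableEq V] (G : SimpleGraph V) (hVT : IsVertexTransitive G)
    {f : (V → Fin 2) → ℂ}
    (hfix : ∀ π : V ≃ V, (∀ x y, G.Adj (π x) (π y) ↔ G.Adj x y) → ∀ σ, f (σ ∘ π) = f σ)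
    (k k' : V) :
    (∑ x, if x = k then 0 else f (Pi.single k 1 + Pi.single x 1)) =
      ∑ x, if x = k' then 0 else f (Pi.single k' 1 + Pi.single x 1) := by
  obtain ⟨φ, hφk⟩ := hVT k k'
  have hk' : φ.toEquiv k = k' := hφk
  refine Fintype.sum_equiv φ.toEquiv _ _ fun x => ?_
  by_cases hx : x = k
  · subst hx
    rw [if_pos rfl, if_pos hk']
  · have hne : φ.toEquiv x ≠ k' := fun h => hx (φ.toEquiv.injective (h.trans hk'.symm))
    rw [if_neg hx, if_neg hne, ← hk']
    have key : (Pi.single (φ.toEquiv k) (1 : Fin 2) + Pi.single (φ.toEquiv x) 1 : V → Fin 2) =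
        (Pi.single k 1 + Pi.single x 1 : V → Fin 2) ∘ φ.toEquiv.symm := by
      rw [pair_comp_equiv, Equiv.symm_symm]
    rw [key, hfix φ.toEquiv.symm (adj_symm_iff_of_iso φ)]

/-- **The condensate as a flat overlap** (vertex-transitive graph, `f ∈ K` fixed by all graph
automorphisms, `k₀` any vertex): `Λ(f) = (4/|V|)·|⟨φ, f⟩|² + (|V| − 4)·‖f‖²`.  (The marginals are all
equal to `2⟨φ,f⟩/|V|`; `condensate_eq_pair`.) Tasaki (2020) App. A.3. [folklore] -/
theorem condensate_eq_flatOverlap (G : SimpleGraph V) (hVT : IsVertexTransitive G) (k₀ : V)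
    {φ : (V → Fin 2) → ℂ} (hφ : ∀ σ, φ σ = if (∑ z, (σ z : ℕ)) = 2 then 1 else 0)
    {f : (V → Fin 2) → ℂ} (hfK : f ∈ spinZSector (Λ := V) 1 ((Fintype.card V : ℝ) / 2 - 2))
    (hfix : ∀ π : V ≃ V, (∀ x y, G.Adj (π x) (π y) ↔ G.Adj x y) → ∀ σ, f (σ ∘ π) = f σ) :
    (star f ⬝ᵥ (((∑ x, onSite x (spinRaise 1)) * (∑ y, onSite y (spinLower 1)) : Op V 2) *ᵥ f)).re =
      4 / (Fintype.card V : ℝ) * ‖star φ ⬝ᵥ f‖ ^ 2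
        + ((Fintype.card V : ℝ) - 4) * (star f ⬝ᵥ f).re := by
  have hsupp := apply_eq_zero_of_mem_twoMagnonSector hfK
  rw [condensate_eq_pair hfK]
  set m : ℂ := ∑ x, if x = k₀ then 0 else f (Pi.single k₀ 1 + Pi.single x 1) with hmdef
  have hmk : ∀ k, (∑ x, if x = k then 0 else f (Pi.single k 1 + Pi.single x 1)) = m :=
    fun k => marginal_eq_of_vertexTransitive G hVT hfix k k₀
  have hsum : ∑ k, ((∑ x, (if x = k then 0 else f (Pi.single k 1 + Pi.single x 1))).re ^ 2 +
      (∑ x, (if x = k then 0 else f (Pi.single k 1 + Pi.single x 1))).im ^ 2) =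
      (Fintype.card V : ℝ) * ‖m‖ ^ 2 := by
    rw [Finset.sum_congr rfl fun k _ => by rw [hmk k], Finset.sum_const, Finset.card_univ,
      nsmul_eq_mul, Complex.sq_norm, Complex.normSq_apply]
    ring
  -- `|V| m = Σ_k m_k = 2 Σ_σ f σ = 2 ⟨φ, f⟩`
  have htot : (Fintype.card V : ℂ) * m = 2 * (star φ ⬝ᵥ f) := by
    have h2 := two_smul_sum_eq_sum_pairs f hsupp
    have hmk' : ∀ k, (∑ x, if k = x then 0 else f (Pi.single k 1 + Pi.single x 1)) = m := by
      intro k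
      rw [← hmk k]
      exact Finset.sum_congr rfl fun x _ => if_congr eq_comm rfl rfl
    rw [Finset.sum_congr rfl fun k _ => hmk' k, Finset.sum_const, Finset.card_univ, nsmul_eq_mul,
      nsmul_eq_mul, Nat.cast_ofNat] at h2
    rw [star_flat_dotProduct hφ hsupp]
    exact h2.symm
  have hn : (0 : ℝ) < Fintype.card V := by
    have : 0 < Fintype.card V := Fintype.card_pos_iff.2 ⟨k₀⟩
    exact_mod_cast this
  have hnC : (Fintype.card V : ℂ) ≠ 0 := by exact_mod_cast hn.ne'
  have hm : ‖m‖ ^ 2 = 4 * ‖star φ ⬝ᵥ f‖ ^ 2 / (Fintype.card V : ℝ) ^ 2 := by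
    have h1 : m = 2 * (star φ ⬝ᵥ f) / (Fintype.card V : ℂ) := by
      rw [eq_div_iff hnC, mul_comm, htot]
    rw [h1, norm_div, norm_mul, Complex.norm_natCast, div_pow, mul_pow]
    norm_num
  rw [hsum, hm]
  have hn0 : (Fintype.card V : ℝ) ≠ 0 := hn.ne'
  field_simp
  ring


end Summit.HubbardSuperconductivity.HubbardSuperconductivity.Theorems.AnisotropyChord.TwoMagnon
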